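import Literature.ModelTheory.ExponentialFields.Wilkie1989Lemma3
import Literature.Analysis.Calculus.SimplifiedNewton
import Mathlib.LinearAlgebra.Matrix.ToLin
import Mathlib.LinearAlgebra.Matrix.NonsingularInverse
import Mathlib.Topology.Algebra.Module.FiniteDimension
import HarnessLib

/-!
# Newton approximation for square systems of exponential terms over `ℝ`, with explicit majorants

Family `periods` (periods.S27), topic `Literature/ModelTheory/ExponentialFields`: the real-analytic
input (B1′) of the conditional half of Macintyre–Wilkie's theorem
(`Literature.ModelTheory.ExponentialFields.macintyreWilkie_existential_of_schanuelProperty`).  Macintyre–Wilkie 1996,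
Thm. 4.1 (as transposed by Jones–Servi 2011, **Lemma 3.5**): "There is an effective procedure
which, given `n, N ∈ ℕ` and `F = (f₁, …, fₙ)`, produces `θ = θ(n, N, F) ∈ ℕ` such that
`T ⊨ ∀x̄₀ (‖x̄₀‖ < N, ‖F(x̄₀)‖ < θ⁻¹, |JF(x̄₀)| > N⁻¹ ⇒ ∃x̄ ∈ B(x̄₀, N⁻¹) ∩ V^{reg}(F))`",
proved there from a quantitative Newton theorem ([Servi08, Thm. 1.4.1]) and *a priori* bounds
"`∀x̄ ∈ B(0, N+1) |F'(x̄)|, |F''(x̄)|, max |c_{ij}(x̄)|, … < θ₀`" obtained because "if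
`h ∈ M_n(ℤ[α])`, then in `K` we can effectively bound the norm of `h(x̄)` for `x̄ ∈ B(0, N+1)`".

This file proves the **real** (`K = ℝ`) statement in a form whose hypotheses are finitely many
polynomial (in)equalities between values of exponential terms — so that it can be written as
ONE first-order sentence per system and transferred (`NewtonSentences.lean`, to come):

* `opNorm_le_sum_norm_apply_single` — sup-norm operator bound by the images of the coordinate
  vectors;
* `NewtonExp.majFun ν t` / `NewtonExp.majTerm` — the **structural majorant** of a
  parameter-free term (`xᵢ ↦ ν`, `0, 1 ↦ 0, 1`, `+ ↦ +`, `* ↦ *`, `- ↦ id`, `exp ↦ exp`): a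
  real number, resp. a term in one variable, with `|t(ȳ)| ≤ majFun ν t` on the box `|yᵢ| ≤ ν`
  (`abs_realize_le_majFun`) and `(majTerm t).realize ν = majFun ν t`;
* `NewtonExp.jacFun F x` (the matrix of gradient rows `RealExpModel.grad`, = `κ = Empty` case of
  `RealExpModel.jacobian`) and `NewtonExp.lipschitzConst F ν = Σ_{i,j,k} majFun ν (∂ₖ∂ⱼFᵢ)` and
  `NewtonExp.norm_fderiv_sub_fderiv_le` — on the box, the Jacobian (Fréchet derivative) of the map
  `RealExpModel.sysFun F Empty.elim` (`Wilkie1989Lemma3.lean`) of a square system `F` of terms is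
  Lipschitz with that explicit constant (mean value inequality entrywise,
  `RealExpModel.fderiv_realize_single`; grouping namespace `NewtonExp`);
* `NewtonExp.exists_zero_of_newtonHyp` — **the Newton statement**: if `B · JF(q̄) = 1`,
  `|Bᵢⱼ| ≤ β`, `|Fᵢ(q̄)| ≤ δ`, `|qᵢ| + 2nβδ ≤ ν` and
  `4 · lipschitzConst F ν · (nβ) · (nβδ) ≤ 1`, then `F` has a zero `x̄` with
  `|xᵢ − qᵢ| ≤ 2nβδ` at which the Jacobian is invertible (from
  `Literature.Analysis.Calculus.exists_zero_near_of_simplifiedNewton`, Magnus 2022 Prop. 6.7);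
* variants `NewtonExp.exists_zero_of_newtonHyp_of_lipschitz` (any Lipschitz bound `M` for the
  Jacobian on the box) and `NewtonExp.exists_zero_of_newtonHyp_of_terms` (Jacobian entries and
  their derivatives realized by auxiliary terms `G i j`, `H i j k` — the form used for flat
  exponential polynomials, whose derivatives are computed on the monomial codes), with
  `NewtonExp.norm_fderiv_sub_fderiv_le_of_terms`.

## Library search

The map of a system of terms, its smoothness and the formula for its derivative are the tree's
`RealExpModel.sysFun h c`, `RealExpModel.contDiff_sysFun`, `RealExpModel.fderiv_sysFun_apply`
(`Wilkie1989Lemma3.lean`, for `p` terms with parameters `κ`; used here with `κ = Empty`,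
`c = Empty.elim`) together with `RealExpModel.grad` (`RealExpLagrange.lean`); nothing is
redefined.  The simplified Newton theorem is `Literature/Analysis/Calculus/SimplifiedNewton.lean`.

## References

* A. Macintyre, A. J. Wilkie, *On the decidability of the real exponential field* (1996), Thm. 4.1.
* G. O. Jones, T. Servi, *On the decidability of the real field with a generic power function*,
  J. Symb. Log. 76 (2011), Lemma 3.5.
* R. Magnus, *Metric Spaces: A Companion to Analysis* (2022), Prop. 6.7.
-/

noncomputable section

open FirstOrder FirstOrder.Language Metric Set
open scoped BigOperators Matrix

namespace Literature.ModelTheory.ExponentialFields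

/-! ### Sup-norm operator bounds by coordinate images -/

section SupNorm

variable {n : ℕ} {G : Type*} [NormedAddCommGroup G] [NormedSpace ℝ G]

/-- For a continuous linear map out of `ℝⁿ` (sup norm), `‖L‖ ≤ Σⱼ ‖L eⱼ‖`. [folklore] -/
theorem opNorm_le_sum_norm_apply_single (L : (Fin n → ℝ) →L[ℝ] G) :
    ‖L‖ ≤ ∑ j, ‖L (Pi.single j 1)‖ := by
  classical
  refine ContinuousLinearMap.opNorm_le_bound _ (Finset.sum_nonneg fun _ _ => norm_nonneg _) ?_
  intro v
  have hv : v = ∑ j, v j • (Pi.single j (1 : ℝ) : Fin n → ℝ) := by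
    ext i
    simp [Finset.sum_apply, Pi.single_apply]
  calc ‖L v‖ = ‖∑ j, v j • L (Pi.single j 1)‖ := by
        conv_lhs => rw [hv]
        simp [map_sum, map_smul]
    _ ≤ ∑ j, ‖v j • L (Pi.single j 1)‖ := norm_sum_le _ _
    _ = ∑ j, |v j| * ‖L (Pi.single j 1)‖ := by simp [norm_smul]
    _ ≤ ∑ j, ‖v‖ * ‖L (Pi.single j 1)‖ := by
        gcongr with j
        exact norm_le_pi_norm v j
    _ = (∑ j, ‖L (Pi.single j 1)‖) * ‖v‖ := by
        rw [Finset.sum_mul]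
        exact Finset.sum_congr rfl fun j _ => mul_comm _ _

/-- Sup norm of a vector of `ℝⁿ` bounded entrywise. [folklore] -/
theorem pi_norm_le_of_forall_abs_le {v : Fin n → ℝ} {c : ℝ} (hc : 0 ≤ c) (h : ∀ i, |v i| ≤ c) :
    ‖v‖ ≤ c :=
  (pi_norm_le_iff_of_nonneg hc).2 fun i => by simpa [Real.norm_eq_abs] using h i

end SupNorm

namespace NewtonExp

open RealExpModel

/-! ### Structural majorants of parameter-free terms -/

section Majorant

variable {n : ℕ}

/-- The **structural majorant** of a parameter-free exponential term at radius `ν`: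
`xᵢ ↦ ν`, `0 ↦ 0`, `1 ↦ 1`, `s + t ↦ maj s + maj t`, `s * t ↦ maj s * maj t`, `-s ↦ maj s`,
`exp s ↦ exp (maj s)`; it bounds `|t(ȳ)|` on the box `|yᵢ| ≤ ν` (`abs_realize_le_majFun`) — the
"effective bound of the norm of `h(x̄)` for `x̄ ∈ B(0, N+1)`" of Jones–Servi 2011, proof of
Lemma 3.5. [cite: JonesServi2011, Lemma 3.5 (proof)] -/
def majFun (ν : ℝ) : Language.orderedExpRing.Term (Empty ⊕ Fin n) → ℝ
  | var _ => ν
  | func expRingFunc.add ts => (fun i => majFun ν (ts i)) 0 + (fun i => majFun ν (ts i)) 1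
  | func expRingFunc.mul ts => (fun i => majFun ν (ts i)) 0 * (fun i => majFun ν (ts i)) 1
  | func expRingFunc.neg ts => (fun i => majFun ν (ts i)) 0
  | func expRingFunc.zero _ => 0
  | func expRingFunc.one _ => 1
  | func expRingFunc.exp ts => Real.exp ((fun i => majFun ν (ts i)) 0)

/-- The majorant is non-negative for `ν ≥ 0`. [folklore] -/
theorem majFun_nonneg {ν : ℝ} (hν : 0 ≤ ν) :
    ∀ t : Language.orderedExpRing.Term (Empty ⊕ Fin n), 0 ≤ majFun ν t
  | var _ => hν
  | func expRingFunc.add ts => add_nonneg (majFun_nonneg hν (ts 0)) (majFun_nonneg hν (ts 1))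
  | func expRingFunc.mul ts => mul_nonneg (majFun_nonneg hν (ts 0)) (majFun_nonneg hν (ts 1))
  | func expRingFunc.neg ts => majFun_nonneg hν (ts 0)
  | func expRingFunc.zero _ => le_rfl
  | func expRingFunc.one _ => zero_le_one
  | func expRingFunc.exp _ => (Real.exp_pos _).le

/-- **The majorant bounds the term on the box**: if `|yᵢ| ≤ ν` for all `i` then
`|t(ȳ)| ≤ majFun ν t`. [cite: JonesServi2011, Lemma 3.5 (proof)] -/
theorem abs_realize_le_majFun {ν : ℝ} {y : Fin n → ℝ} (hy : ∀ i, |y i| ≤ ν) :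
    ∀ t : Language.orderedExpRing.Term (Empty ⊕ Fin n),
      |t.realize (Sum.elim (Empty.elim : Empty → ℝ) y)| ≤ majFun ν t
  | var (Sum.inl e) => e.elim
  | var (Sum.inr i) => by simpa [majFun] using hy i
  | func expRingFunc.add ts => by
    have h0 := abs_realize_le_majFun hy (ts 0)
    have h1 := abs_realize_le_majFun hy (ts 1)
    simp only [Term.realize, RealExpModel.LawfulStructure.funMap_add, majFun]
    exact (abs_add_le _ _).trans (add_le_add h0 h1)
  | func expRingFunc.mul ts => by
    have h0 := abs_realize_le_majFun hy (ts 0)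
    have h1 := abs_realize_le_majFun hy (ts 1)
    simp only [Term.realize, RealExpModel.LawfulStructure.funMap_mul, majFun]
    rw [abs_mul]
    exact mul_le_mul h0 h1 (abs_nonneg _) ((abs_nonneg _).trans h0)
  | func expRingFunc.neg ts => by
    have h0 := abs_realize_le_majFun hy (ts 0)
    simp only [Term.realize, RealExpModel.LawfulStructure.funMap_neg, majFun, abs_neg]
    exact h0
  | func expRingFunc.zero _ => by
    simp [Term.realize, majFun]
  | func expRingFunc.one _ => by
    simp [Term.realize, majFun]
  | func expRingFunc.exp ts => by
    have h0 := abs_realize_le_majFun hy (ts 0)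
    simp only [Term.realize, majFun]
    show |Real.exp _| ≤ _
    rw [Real.abs_exp]
    exact Real.exp_le_exp.2 ((le_abs_self _).trans h0)

/-- The **majorant term**: the same recursion producing a term in one variable `w`
(standing for `ν`), so that the majorant can be written inside first-order sentences. [folklore] -/
def majTerm {β : Type} (w : Language.orderedExpRing.Term β) :
    Language.orderedExpRing.Term (Empty ⊕ Fin n) → Language.orderedExpRing.Term β
  | var _ => w
  | func expRingFunc.add ts => (fun i => majTerm w (ts i)) 0 + (fun i => majTerm w (ts i)) 1
  | func expRingFunc.mul ts => (fun i => majTerm w (ts i)) 0 * (fun i => majTerm w (ts i)) 1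
  | func expRingFunc.neg ts => (fun i => majTerm w (ts i)) 0
  | func expRingFunc.zero _ => 0
  | func expRingFunc.one _ => 1
  | func expRingFunc.exp ts => Language.orderedExpRing.termExp ((fun i => majTerm w (ts i)) 0)

/-- In `ℝ`, the majorant term realizes to the majorant value at the value of `w`. [folklore] -/
theorem realize_majTerm {β : Type} (w : Language.orderedExpRing.Term β) (v : β → ℝ) :
    ∀ t : Language.orderedExpRing.Term (Empty ⊕ Fin n),
      (majTerm w t).realize v = majFun (w.realize v) t
  | var _ => rfl
  | func expRingFunc.add ts => by
    simp only [majTerm, majFun, ExpTerm.realize_add, realize_majTerm w v (ts 0), realize_majTerm w v (ts 1)]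
  | func expRingFunc.mul ts => by
    simp only [majTerm, majFun, ExpTerm.realize_mul, realize_majTerm w v (ts 0), realize_majTerm w v (ts 1)]
  | func expRingFunc.neg ts => by
    simp only [majTerm, majFun, realize_majTerm w v (ts 0)]
  | func expRingFunc.zero _ => by simp [majTerm, majFun]
  | func expRingFunc.one _ => by simp [majTerm, majFun]
  | func expRingFunc.exp ts => by
    simp only [majTerm, majFun, ExpTerm.realize_termExp_eq_funMap, realize_majTerm w v (ts 0)]
    rfl

end Majorant

/-! ### The map of a square system of terms and its Jacobian -/

section System

variable {n : ℕ} (F : Fin n → Language.orderedExpRing.Term (Empty ⊕ Fin n))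

/-- The Jacobian matrix of a square system of parameter-free terms at a point: the matrix of the
gradient rows `RealExpModel.grad` (realizations of Wilkie's formal partial derivatives,
`RealExpLagrange.lean`), i.e. the real case `κ = Empty` of `RealExpModel.jacobian`
(`Wilkie1989.lean`); by `RealExpModel.fderiv_sysFun_apply` (`Wilkie1989Lemma3.lean`) the Fréchet
derivative of the map `RealExpModel.sysFun F Empty.elim` of the system is multiplication by it. [cite: Wilkie1989, §1, p. 385] -/
abbrev jacFun (x : Fin n → ℝ) : Matrix (Fin n) (Fin n) ℝ :=
  Matrix.of fun i => grad (F i) Empty.elim x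

/-- Entries of the Jacobian matrix. [folklore] -/
theorem jacFun_apply (x : Fin n → ℝ) (i j : Fin n) :
    jacFun F x i j = (termPDeriv j (F i)).realize (Sum.elim Empty.elim x) := rfl

/-- The map of a system is differentiable (`RealExpModel.contDiff_sysFun`). [folklore] -/
theorem differentiable_sysFun : Differentiable ℝ (sysFun F Empty.elim) :=
  (contDiff_sysFun F Empty.elim (m := 1)).differentiable (by simp)

/-- The Fréchet derivative of the map of a system on a coordinate vector is the corresponding
column of the Jacobian matrix (`RealExpModel.fderiv_sysFun_apply`). [folklore] -/
theorem fderiv_sysFun_single (x : Fin n → ℝ) (j : Fin n) :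
    fderiv ℝ (sysFun F Empty.elim) x (Pi.single j 1) = fun i => jacFun F x i j := by
  classical
  rw [fderiv_sysFun_apply]
  ext i
  simp [Matrix.mulVec, dotProduct, Pi.single_apply]

/-- The matrix of the Fréchet derivative of the map of a system is the Jacobian matrix. [folklore] -/
theorem toMatrix'_fderiv_eq_jacFun (x : Fin n → ℝ) :
    LinearMap.toMatrix' (fderiv ℝ (sysFun F Empty.elim) x : (Fin n → ℝ) →ₗ[ℝ] (Fin n → ℝ)) =
      jacFun F x := by
  ext i j
  rw [LinearMap.toMatrix'_apply, ContinuousLinearMap.coe_coe, fderiv_sysFun_single]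

/-- The explicit **Lipschitz constant of the Jacobian on the box of radius `ν`**:
`Σ_{i,j,k} majFun ν (∂ₖ ∂ⱼ Fᵢ)`. [cite: JonesServi2011, Lemma 3.5 (proof)] -/
def lipschitzConst (ν : ℝ) : ℝ :=
  ∑ i, ∑ j, ∑ k, majFun ν (termPDeriv k (termPDeriv j (F i)))

/-- The Lipschitz constant is non-negative for `ν ≥ 0`. [folklore] -/
theorem lipschitzConst_nonneg {ν : ℝ} (hν : 0 ≤ ν) : 0 ≤ lipschitzConst F ν :=
  Finset.sum_nonneg fun _ _ => Finset.sum_nonneg fun _ _ => Finset.sum_nonneg fun _ _ =>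
    majFun_nonneg hν _

/-- A scalar term is Lipschitz on the box with constant the sum of the majorants of its partial
derivatives (mean value inequality). [folklore] -/
theorem abs_realize_sub_realize_le {ν : ℝ} (t : Language.orderedExpRing.Term (Empty ⊕ Fin n))
    {x a : Fin n → ℝ} (hx : ∀ i, |x i| ≤ ν) (ha : ∀ i, |a i| ≤ ν) :
    |t.realize (Sum.elim Empty.elim x) - t.realize (Sum.elim Empty.elim a)| ≤
      (∑ k, majFun ν (termPDeriv k t)) * ‖x - a‖ := by
  classical
  let f : (Fin n → ℝ) → ℝ := fun y => t.realize (Sum.elim Empty.elim y)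
  let s : Set (Fin n → ℝ) := {y | ∀ i, |y i| ≤ ν}
  have hs : Convex ℝ s := by
    intro y hy z hz a b ha hb hab i
    calc |(a • y + b • z) i| = |a * y i + b * z i| := by simp
      _ ≤ |a * y i| + |b * z i| := abs_add_le _ _
      _ = a * |y i| + b * |z i| := by rw [abs_mul, abs_mul, abs_of_nonneg ha, abs_of_nonneg hb]
      _ ≤ a * ν + b * ν := add_le_add (mul_le_mul_of_nonneg_left (hy i) ha)
          (mul_le_mul_of_nonneg_left (hz i) hb)
      _ = ν := by rw [← add_mul, hab, one_mul]
  have hderiv : ∀ y ∈ s, HasFDerivWithinAt f (fderiv ℝ f y) s y := fun y _ =>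
    (hasStrictFDerivAt_realize t Empty.elim y).hasFDerivAt.hasFDerivWithinAt
  have hbound : ∀ y ∈ s, ‖fderiv ℝ f y‖ ≤ ∑ k, majFun ν (termPDeriv k t) := by
    intro y hy
    refine (opNorm_le_sum_norm_apply_single _).trans (Finset.sum_le_sum fun k _ => ?_)
    rw [show fderiv ℝ f y (Pi.single k 1) = (termPDeriv k t).realize (Sum.elim Empty.elim y) from
      fderiv_realize_single t Empty.elim y k, Real.norm_eq_abs]
    exact abs_realize_le_majFun hy _
  have := hs.norm_image_sub_le_of_norm_hasFDerivWithin_le hderiv hbound ha hx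
  simpa [f, Real.norm_eq_abs] using this

/-- **The Jacobian is Lipschitz on the box with the explicit constant**:
`‖DF(x) − DF(a)‖ ≤ lipschitzConst F ν · ‖x − a‖` for `x, a` in the box `|yᵢ| ≤ ν`
(entrywise mean value inequality and the sup-norm operator bound). [cite: JonesServi2011, Lemma 3.5 (proof)] -/
theorem norm_fderiv_sub_fderiv_le {ν : ℝ} {x a : Fin n → ℝ} (hx : ∀ i, |x i| ≤ ν)
    (ha : ∀ i, |a i| ≤ ν) :
    ‖fderiv ℝ (sysFun F Empty.elim) x - fderiv ℝ (sysFun F Empty.elim) a‖ ≤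
      lipschitzConst F ν * ‖x - a‖ := by
  classical
  have hcol : ∀ j, (fderiv ℝ (sysFun F Empty.elim) x - fderiv ℝ (sysFun F Empty.elim) a) (Pi.single j 1) =
      fun i => jacFun F x i j - jacFun F a i j := by
    intro j
    ext i
    simp only [FunLike.coe_sub, Pi.sub_apply, fderiv_sysFun_single]
  have hentry : ∀ i j, |jacFun F x i j - jacFun F a i j| ≤
      (∑ k, majFun ν (termPDeriv k (termPDeriv j (F i)))) * ‖x - a‖ := fun i j =>
    abs_realize_sub_realize_le (termPDeriv j (F i)) hx ha
  calc ‖fderiv ℝ (sysFun F Empty.elim) x - fderiv ℝ (sysFun F Empty.elim) a‖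
      ≤ ∑ j, ‖(fderiv ℝ (sysFun F Empty.elim) x - fderiv ℝ (sysFun F Empty.elim) a) (Pi.single j 1)‖ :=
        opNorm_le_sum_norm_apply_single _
    _ ≤ ∑ j, ∑ i, (∑ k, majFun ν (termPDeriv k (termPDeriv j (F i)))) * ‖x - a‖ := by
        refine Finset.sum_le_sum fun j _ => ?_
        rw [hcol j]
        have hnn : ∀ i, 0 ≤ (∑ k, majFun ν (termPDeriv k (termPDeriv j (F i)))) * ‖x - a‖ :=
          fun i => (abs_nonneg _).trans (hentry i j)
        refine (pi_norm_le_iff_of_nonneg (Finset.sum_nonneg fun i _ => hnn i)).2 fun i => ?_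
        rw [Real.norm_eq_abs]
        exact (hentry i j).trans (Finset.single_le_sum (fun i _ => hnn i) (Finset.mem_univ i))
    _ = lipschitzConst F ν * ‖x - a‖ := by
        rw [lipschitzConst, Finset.sum_comm, Finset.sum_mul]
        refine Finset.sum_congr rfl fun i _ => ?_
        rw [Finset.sum_mul]

/-! ### The Newton statement for square systems of exponential terms -/

/-- **Newton approximation for a square system of exponential terms over `ℝ`, with explicit
data** (Macintyre–Wilkie 1996, Thm. 4.1; Jones–Servi 2011, Lemma 3.5, real case).  Let
`F = (F₁, …, Fₙ)` be parameter-free exponential terms in `x₁, …, xₙ`, `q̄ ∈ ℝⁿ`, `B` an `n × n`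
real matrix and `β, δ, ν ≥ 0` reals with: `B · JF(q̄) = 1`, `|Bᵢⱼ| ≤ β`, `|Fᵢ(q̄)| ≤ δ`,
`|qᵢ| + 2nβδ ≤ ν`, and `4 · lipschitzConst F ν · (nβ) · (nβδ) ≤ 1`.  Then there is `x̄ ∈ ℝⁿ`
with `|xᵢ − qᵢ| ≤ 2nβδ`, `F(x̄) = 0`, and `JF(x̄)` invertible — a non-singular zero of `F` near
`q̄`.  (From `Literature.Analysis.Calculus.exists_zero_near_of_simplifiedNewton` on `ℝⁿ` with the
sup norm: `‖JF(q̄)⁻¹‖ ≤ nβ`, `‖JF(q̄)⁻¹F(q̄)‖ ≤ nβδ`, and the Jacobian is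
`lipschitzConst F ν`-Lipschitz on the box `|yᵢ| ≤ ν` containing the ball of radius `2nβδ`.)  The
sign hypotheses `0 ≤ β, δ, ν` are redundant for `n ≥ 1` (and the statement is trivial for
`n = 0`); they are kept because the first-order Newton sentence carries them as conjuncts.  This
is the explicit-data Newton step in the *proof* of Jones–Servi's Lemma 3.5 (the printed lemma is
the `θ(n, N, F)` statement, for power functions), not that lemma itself. [cite: JonesServi2011, Lemma 3.5 (proof)] -/
theorem exists_zero_of_newtonHyp {q : Fin n → ℝ} {B : Matrix (Fin n) (Fin n) ℝ} {β δ ν : ℝ}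
    (hβ₀ : 0 ≤ β) (hδ₀ : 0 ≤ δ) (hν₀ : 0 ≤ ν)
    (hB : B * jacFun F q = 1) (hβ : ∀ i j, |B i j| ≤ β) (hδ : ∀ i, |sysFun F Empty.elim q i| ≤ δ)
    (hν : ∀ i, |q i| + 2 * (n * β * δ) ≤ ν)
    (hsmall : 4 * lipschitzConst F ν * (n * β) * (n * β * δ) ≤ 1) :
    ∃ x : Fin n → ℝ, (∀ i, |x i - q i| ≤ 2 * (n * β * δ)) ∧ sysFun F Empty.elim x = 0 ∧
      ∃ B' : Matrix (Fin n) (Fin n) ℝ, B' * jacFun F x = 1 := by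
  classical
  set f := sysFun F Empty.elim with hf_def
  have hf : ∀ x, HasFDerivAt f (fderiv ℝ f x) x := fun x =>
    ((differentiable_sysFun F) x).hasFDerivAt
  -- the derivative at `q` as a continuous linear equivalence `A`, with inverse given by `B`
  set L : (Fin n → ℝ) →L[ℝ] (Fin n → ℝ) := fderiv ℝ f q with hL
  let G : (Fin n → ℝ) →L[ℝ] (Fin n → ℝ) := LinearMap.toContinuousLinearMap (Matrix.toLin' B)
  have hGapply : ∀ v, G v = B.mulVec v := fun v => by simp [G]
  have hjacB : jacFun F q * B = 1 := mul_eq_one_comm.1 hB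
  have hGL : ∀ v, G (L v) = v := fun v => by
    rw [hGapply, hL, fderiv_sysFun_apply, Matrix.mulVec_mulVec, hB, Matrix.one_mulVec]
  have hLG : ∀ v, L (G v) = v := fun v => by
    rw [hGapply, hL, fderiv_sysFun_apply, Matrix.mulVec_mulVec, hjacB, Matrix.one_mulVec]
  let A : (Fin n → ℝ) ≃L[ℝ] (Fin n → ℝ) := ContinuousLinearEquiv.equivOfInverse L G hGL hLG
  have hA : fderiv ℝ f q = (A : (Fin n → ℝ) →L[ℝ] (Fin n → ℝ)) := rfl
  have hAsymm : ∀ w, A.symm w = G w := fun w => rfl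
  -- norm estimates
  have hG : ‖(A.symm : (Fin n → ℝ) →L[ℝ] (Fin n → ℝ))‖ ≤ n * β := by
    refine (opNorm_le_sum_norm_apply_single _).trans ?_
    have hcol : ∀ j, ‖(A.symm : (Fin n → ℝ) →L[ℝ] (Fin n → ℝ)) (Pi.single j 1)‖ ≤ β := by
      intro j
      have e : (A.symm : (Fin n → ℝ) →L[ℝ] (Fin n → ℝ)) (Pi.single j 1) = fun i => B i j := by
        show A.symm (Pi.single j 1) = _
        rw [hAsymm, hGapply]
        ext i
        simp [Matrix.mulVec, dotProduct, Pi.single_apply]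
      rw [e]
      exact pi_norm_le_of_forall_abs_le hβ₀ fun i => hβ i j
    calc ∑ j, ‖(A.symm : (Fin n → ℝ) →L[ℝ] (Fin n → ℝ)) (Pi.single j 1)‖
        ≤ ∑ _j : Fin n, β := Finset.sum_le_sum fun j _ => hcol j
      _ = n * β := by simp
  have hfq : ‖f q‖ ≤ δ := pi_norm_le_of_forall_abs_le hδ₀ hδ
  have hη : ‖A.symm (f q)‖ ≤ n * β * δ := by
    have h1 : ‖A.symm (f q)‖ ≤ ‖(A.symm : (Fin n → ℝ) →L[ℝ] (Fin n → ℝ))‖ * ‖f q‖ :=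
      (A.symm : (Fin n → ℝ) →L[ℝ] (Fin n → ℝ)).le_opNorm (f q)
    calc ‖A.symm (f q)‖ ≤ ‖(A.symm : (Fin n → ℝ) →L[ℝ] (Fin n → ℝ))‖ * ‖f q‖ := h1
      _ ≤ (n * β) * δ := mul_le_mul hG hfq (norm_nonneg _) (by positivity)
      _ = n * β * δ := by ring
  -- the Newton ball lies in the box of radius `ν`
  have hnn : 0 ≤ (n : ℝ) * β * δ := by positivity
  have hq_box : ∀ i, |q i| ≤ ν := fun i => by
    have := hν i
    linarith
  have hbox : ∀ x ∈ closedBall q (2 * ‖A.symm (f q)‖), ∀ i, |x i| ≤ ν := by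
    intro x hx i
    rw [mem_closedBall, dist_eq_norm] at hx
    have h1 : |x i - q i| ≤ 2 * (n * β * δ) := by
      have h2 : |x i - q i| ≤ ‖x - q‖ := by
        simpa [Real.norm_eq_abs] using norm_le_pi_norm (x - q) i
      linarith
    have h3 : |x i| ≤ |q i| + |x i - q i| := by
      have := abs_add_le (q i) (x i - q i)
      rwa [add_sub_cancel] at this
    have h4 := hν i
    linarith
  have hMlip : ∀ x ∈ closedBall q (2 * ‖A.symm (f q)‖),
      ‖fderiv ℝ f x - fderiv ℝ f q‖ ≤ lipschitzConst F ν * ‖x - q‖ := fun x hx =>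
    norm_fderiv_sub_fderiv_le F (hbox x hx) hq_box
  have hM₀ : 0 ≤ lipschitzConst F ν := lipschitzConst_nonneg F hν₀
  have hsmall' : 4 * lipschitzConst F ν * ‖(A.symm : (Fin n → ℝ) →L[ℝ] (Fin n → ℝ))‖ *
      ‖A.symm (f q)‖ ≤ 1 := by
    calc 4 * lipschitzConst F ν * ‖(A.symm : (Fin n → ℝ) →L[ℝ] (Fin n → ℝ))‖ * ‖A.symm (f q)‖
        ≤ 4 * lipschitzConst F ν * (n * β) * (n * β * δ) := by
          gcongr
      _ ≤ 1 := hsmall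
  obtain ⟨x, hx, hfx, hinv, -, -⟩ :=
    Literature.Analysis.Calculus.exists_zero_near_of_simplifiedNewton (f := f)
      (f' := fun x => fderiv ℝ f x) hM₀ (fun x _ => hf x) hA hMlip hsmall'
  refine ⟨x, fun i => ?_, hfx, ?_⟩
  · rw [mem_closedBall, dist_eq_norm] at hx
    have h2 : |x i - q i| ≤ ‖x - q‖ := by
      simpa [Real.norm_eq_abs] using norm_le_pi_norm (x - q) i
    linarith
  · obtain ⟨e, he⟩ := hinv
    refine ⟨LinearMap.toMatrix' (e.symm : (Fin n → ℝ) →L[ℝ] (Fin n → ℝ)), ?_⟩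
    rw [← toMatrix'_fderiv_eq_jacFun, ← he, ← LinearMap.toMatrix'_comp]
    have : ((e.symm : (Fin n → ℝ) →L[ℝ] (Fin n → ℝ)) : (Fin n → ℝ) →ₗ[ℝ] (Fin n → ℝ)) ∘ₗ
        ((e : (Fin n → ℝ) →L[ℝ] (Fin n → ℝ)) : (Fin n → ℝ) →ₗ[ℝ] (Fin n → ℝ)) = LinearMap.id := by
      ext v
      simp
    rw [this, LinearMap.toMatrix'_id]

/-! ### Variants with the Jacobian entries and their derivatives given by auxiliary terms

For flat exponential polynomials (integer monomial codes) the partial derivatives are again flat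
exponential polynomials computed *on the codes*, and the first-order Newton sentences are best
written with those (so that their Gödel numbers are computable without symbolic differentiation
of terms).  The following variants therefore take square arrays of terms `G i j` and `H i j k`
that *realize* (in `ℝ`) to the Jacobian entries `∂ⱼFᵢ` and to their partial derivatives
`∂ₖ∂ⱼFᵢ`, and an arbitrary Lipschitz bound `M`. -/

/-- A scalar term whose partial derivatives are realized by given terms `D k` is Lipschitz on the
box with constant `Σₖ majFun ν (D k)` (mean value inequality; variant of
`abs_realize_sub_realize_le`). [folklore] -/
theorem abs_realize_sub_realize_le_of_fderiv_eq {ν : ℝ}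
    (t : Language.orderedExpRing.Term (Empty ⊕ Fin n))
    (D : Fin n → Language.orderedExpRing.Term (Empty ⊕ Fin n))
    (hD : ∀ (y : Fin n → ℝ) (k : Fin n),
      fderiv ℝ (fun y : Fin n → ℝ => t.realize (Sum.elim Empty.elim y)) y (Pi.single k 1) =
        (D k).realize (Sum.elim Empty.elim y))
    {x a : Fin n → ℝ} (hx : ∀ i, |x i| ≤ ν) (ha : ∀ i, |a i| ≤ ν) :
    |t.realize (Sum.elim Empty.elim x) - t.realize (Sum.elim Empty.elim a)| ≤
      (∑ k, majFun ν (D k)) * ‖x - a‖ := by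
  classical
  let f : (Fin n → ℝ) → ℝ := fun y => t.realize (Sum.elim Empty.elim y)
  let s : Set (Fin n → ℝ) := {y | ∀ i, |y i| ≤ ν}
  have hs : Convex ℝ s := by
    intro y hy z hz a b ha hb hab i
    calc |(a • y + b • z) i| = |a * y i + b * z i| := by simp
      _ ≤ |a * y i| + |b * z i| := abs_add_le _ _
      _ = a * |y i| + b * |z i| := by rw [abs_mul, abs_mul, abs_of_nonneg ha, abs_of_nonneg hb]
      _ ≤ a * ν + b * ν := add_le_add (mul_le_mul_of_nonneg_left (hy i) ha)
          (mul_le_mul_of_nonneg_left (hz i) hb)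
      _ = ν := by rw [← add_mul, hab, one_mul]
  have hderiv : ∀ y ∈ s, HasFDerivWithinAt f (fderiv ℝ f y) s y := fun y _ =>
    (hasStrictFDerivAt_realize t Empty.elim y).hasFDerivAt.hasFDerivWithinAt
  have hbound : ∀ y ∈ s, ‖fderiv ℝ f y‖ ≤ ∑ k, majFun ν (D k) := by
    intro y hy
    refine (opNorm_le_sum_norm_apply_single _).trans (Finset.sum_le_sum fun k _ => ?_)
    rw [show fderiv ℝ f y (Pi.single k 1) = (D k).realize (Sum.elim Empty.elim y) from hD y k,
      Real.norm_eq_abs]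
    exact abs_realize_le_majFun hy _
  have := hs.norm_image_sub_le_of_norm_hasFDerivWithin_le hderiv hbound ha hx
  simpa [f, Real.norm_eq_abs] using this

/-- **The Jacobian is Lipschitz on the box, with the constant read off auxiliary terms**: if the
terms `G i j` realize to the Jacobian entries of `F` and the terms `H i j k` to the partial
derivatives of the `G i j`, then `‖DF(x) − DF(a)‖ ≤ (Σ_{i,j,k} majFun ν (H i j k)) · ‖x − a‖` on
the box `|yᵢ| ≤ ν`. [folklore] -/
theorem norm_fderiv_sub_fderiv_le_of_terms {ν : ℝ}
    (G : Fin n → Fin n → Language.orderedExpRing.Term (Empty ⊕ Fin n))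
    (H : Fin n → Fin n → Fin n → Language.orderedExpRing.Term (Empty ⊕ Fin n))
    (hG : ∀ (y : Fin n → ℝ) (i j : Fin n), jacFun F y i j = (G i j).realize (Sum.elim Empty.elim y))
    (hH : ∀ (y : Fin n → ℝ) (i j k : Fin n),
      fderiv ℝ (fun y : Fin n → ℝ => (G i j).realize (Sum.elim Empty.elim y)) y (Pi.single k 1) =
        (H i j k).realize (Sum.elim Empty.elim y))
    {x a : Fin n → ℝ} (hx : ∀ i, |x i| ≤ ν) (ha : ∀ i, |a i| ≤ ν) :
    ‖fderiv ℝ (sysFun F Empty.elim) x - fderiv ℝ (sysFun F Empty.elim) a‖ ≤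
      (∑ i, ∑ j, ∑ k, majFun ν (H i j k)) * ‖x - a‖ := by
  classical
  have hcol : ∀ j, (fderiv ℝ (sysFun F Empty.elim) x - fderiv ℝ (sysFun F Empty.elim) a) (Pi.single j 1) =
      fun i => jacFun F x i j - jacFun F a i j := by
    intro j
    ext i
    simp only [FunLike.coe_sub, Pi.sub_apply, fderiv_sysFun_single]
  have hentry : ∀ i j, |jacFun F x i j - jacFun F a i j| ≤
      (∑ k, majFun ν (H i j k)) * ‖x - a‖ := fun i j => by
    rw [hG x i j, hG a i j]
    exact abs_realize_sub_realize_le_of_fderiv_eq (G i j) (H i j) (fun y k => hH y i j k) hx ha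
  calc ‖fderiv ℝ (sysFun F Empty.elim) x - fderiv ℝ (sysFun F Empty.elim) a‖
      ≤ ∑ j, ‖(fderiv ℝ (sysFun F Empty.elim) x - fderiv ℝ (sysFun F Empty.elim) a) (Pi.single j 1)‖ :=
        opNorm_le_sum_norm_apply_single _
    _ ≤ ∑ j, ∑ i, (∑ k, majFun ν (H i j k)) * ‖x - a‖ := by
        refine Finset.sum_le_sum fun j _ => ?_
        rw [hcol j]
        have hnn : ∀ i, 0 ≤ (∑ k, majFun ν (H i j k)) * ‖x - a‖ :=
          fun i => (abs_nonneg _).trans (hentry i j)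
        refine (pi_norm_le_iff_of_nonneg (Finset.sum_nonneg fun i _ => hnn i)).2 fun i => ?_
        rw [Real.norm_eq_abs]
        exact (hentry i j).trans (Finset.single_le_sum (fun i _ => hnn i) (Finset.mem_univ i))
    _ = (∑ i, ∑ j, ∑ k, majFun ν (H i j k)) * ‖x - a‖ := by
        rw [Finset.sum_comm, Finset.sum_mul]
        refine Finset.sum_congr rfl fun i _ => ?_
        rw [Finset.sum_mul]

/-- **Newton approximation with an arbitrary Lipschitz bound `M` for the Jacobian on the box**
(the core of `exists_zero_of_newtonHyp`, with `lipschitzConst F ν` replaced by any `M ≥ 0` such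
that `‖DF(x) − DF(a)‖ ≤ M‖x − a‖` on the box `|yᵢ| ≤ ν`). [cite: JonesServi2011, Lemma 3.5 (proof)] -/
theorem exists_zero_of_newtonHyp_of_lipschitz {q : Fin n → ℝ} {B : Matrix (Fin n) (Fin n) ℝ}
    {β δ ν M : ℝ} (hβ₀ : 0 ≤ β) (hδ₀ : 0 ≤ δ) (hM₀ : 0 ≤ M)
    (hLip : ∀ x a : Fin n → ℝ, (∀ i, |x i| ≤ ν) → (∀ i, |a i| ≤ ν) →
      ‖fderiv ℝ (sysFun F Empty.elim) x - fderiv ℝ (sysFun F Empty.elim) a‖ ≤ M * ‖x - a‖)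
    (hB : B * jacFun F q = 1) (hβ : ∀ i j, |B i j| ≤ β) (hδ : ∀ i, |sysFun F Empty.elim q i| ≤ δ)
    (hν : ∀ i, |q i| + 2 * (n * β * δ) ≤ ν)
    (hsmall : 4 * M * (n * β) * (n * β * δ) ≤ 1) :
    ∃ x : Fin n → ℝ, (∀ i, |x i - q i| ≤ 2 * (n * β * δ)) ∧ sysFun F Empty.elim x = 0 ∧
      ∃ B' : Matrix (Fin n) (Fin n) ℝ, B' * jacFun F x = 1 := by
  classical
  set f := sysFun F Empty.elim with hf_def
  have hf : ∀ x, HasFDerivAt f (fderiv ℝ f x) x := fun x =>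
    ((differentiable_sysFun F) x).hasFDerivAt
  set L : (Fin n → ℝ) →L[ℝ] (Fin n → ℝ) := fderiv ℝ f q with hL
  let G : (Fin n → ℝ) →L[ℝ] (Fin n → ℝ) := LinearMap.toContinuousLinearMap (Matrix.toLin' B)
  have hGapply : ∀ v, G v = B.mulVec v := fun v => by simp [G]
  have hjacB : jacFun F q * B = 1 := mul_eq_one_comm.1 hB
  have hGL : ∀ v, G (L v) = v := fun v => by
    rw [hGapply, hL, fderiv_sysFun_apply, Matrix.mulVec_mulVec, hB, Matrix.one_mulVec]
  have hLG : ∀ v, L (G v) = v := fun v => by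
    rw [hGapply, hL, fderiv_sysFun_apply, Matrix.mulVec_mulVec, hjacB, Matrix.one_mulVec]
  let A : (Fin n → ℝ) ≃L[ℝ] (Fin n → ℝ) := ContinuousLinearEquiv.equivOfInverse L G hGL hLG
  have hA : fderiv ℝ f q = (A : (Fin n → ℝ) →L[ℝ] (Fin n → ℝ)) := rfl
  have hAsymm : ∀ w, A.symm w = G w := fun w => rfl
  have hG : ‖(A.symm : (Fin n → ℝ) →L[ℝ] (Fin n → ℝ))‖ ≤ n * β := by
    refine (opNorm_le_sum_norm_apply_single _).trans ?_
    have hcol : ∀ j, ‖(A.symm : (Fin n → ℝ) →L[ℝ] (Fin n → ℝ)) (Pi.single j 1)‖ ≤ β := by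
      intro j
      have e : (A.symm : (Fin n → ℝ) →L[ℝ] (Fin n → ℝ)) (Pi.single j 1) = fun i => B i j := by
        show A.symm (Pi.single j 1) = _
        rw [hAsymm, hGapply]
        ext i
        simp [Matrix.mulVec, dotProduct, Pi.single_apply]
      rw [e]
      exact pi_norm_le_of_forall_abs_le hβ₀ fun i => hβ i j
    calc ∑ j, ‖(A.symm : (Fin n → ℝ) →L[ℝ] (Fin n → ℝ)) (Pi.single j 1)‖
        ≤ ∑ _j : Fin n, β := Finset.sum_le_sum fun j _ => hcol j
      _ = n * β := by simp
  have hfq : ‖f q‖ ≤ δ := pi_norm_le_of_forall_abs_le hδ₀ hδ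
  have hη : ‖A.symm (f q)‖ ≤ n * β * δ := by
    have h1 : ‖A.symm (f q)‖ ≤ ‖(A.symm : (Fin n → ℝ) →L[ℝ] (Fin n → ℝ))‖ * ‖f q‖ :=
      (A.symm : (Fin n → ℝ) →L[ℝ] (Fin n → ℝ)).le_opNorm (f q)
    calc ‖A.symm (f q)‖ ≤ ‖(A.symm : (Fin n → ℝ) →L[ℝ] (Fin n → ℝ))‖ * ‖f q‖ := h1
      _ ≤ (n * β) * δ := mul_le_mul hG hfq (norm_nonneg _) (by positivity)
      _ = n * β * δ := by ring
  have hnn : 0 ≤ (n : ℝ) * β * δ := by positivity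
  have hq_box : ∀ i, |q i| ≤ ν := fun i => by
    have := hν i
    linarith
  have hbox : ∀ x ∈ closedBall q (2 * ‖A.symm (f q)‖), ∀ i, |x i| ≤ ν := by
    intro x hx i
    rw [mem_closedBall, dist_eq_norm] at hx
    have h1 : |x i - q i| ≤ 2 * (n * β * δ) := by
      have h2 : |x i - q i| ≤ ‖x - q‖ := by
        simpa [Real.norm_eq_abs] using norm_le_pi_norm (x - q) i
      linarith
    have h3 : |x i| ≤ |q i| + |x i - q i| := by
      have := abs_add_le (q i) (x i - q i)
      rwa [add_sub_cancel] at this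
    have h4 := hν i
    linarith
  have hMlip : ∀ x ∈ closedBall q (2 * ‖A.symm (f q)‖),
      ‖fderiv ℝ f x - fderiv ℝ f q‖ ≤ M * ‖x - q‖ := fun x hx =>
    hLip x q (hbox x hx) hq_box
  have hsmall' : 4 * M * ‖(A.symm : (Fin n → ℝ) →L[ℝ] (Fin n → ℝ))‖ * ‖A.symm (f q)‖ ≤ 1 := by
    calc 4 * M * ‖(A.symm : (Fin n → ℝ) →L[ℝ] (Fin n → ℝ))‖ * ‖A.symm (f q)‖
        ≤ 4 * M * (n * β) * (n * β * δ) := by gcongr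
      _ ≤ 1 := hsmall
  obtain ⟨x, hx, hfx, hinv, -, -⟩ :=
    Literature.Analysis.Calculus.exists_zero_near_of_simplifiedNewton (f := f)
      (f' := fun x => fderiv ℝ f x) hM₀ (fun x _ => hf x) hA hMlip hsmall'
  refine ⟨x, fun i => ?_, hfx, ?_⟩
  · rw [mem_closedBall, dist_eq_norm] at hx
    have h2 : |x i - q i| ≤ ‖x - q‖ := by
      simpa [Real.norm_eq_abs] using norm_le_pi_norm (x - q) i
    linarith
  · obtain ⟨e, he⟩ := hinv
    refine ⟨LinearMap.toMatrix' (e.symm : (Fin n → ℝ) →L[ℝ] (Fin n → ℝ)), ?_⟩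
    rw [← toMatrix'_fderiv_eq_jacFun, ← he, ← LinearMap.toMatrix'_comp]
    have : ((e.symm : (Fin n → ℝ) →L[ℝ] (Fin n → ℝ)) : (Fin n → ℝ) →ₗ[ℝ] (Fin n → ℝ)) ∘ₗ
        ((e : (Fin n → ℝ) →L[ℝ] (Fin n → ℝ)) : (Fin n → ℝ) →ₗ[ℝ] (Fin n → ℝ)) = LinearMap.id := by
      ext v
      simp
    rw [this, LinearMap.toMatrix'_id]

/-- **Newton approximation with the Jacobian entries and their derivatives given by auxiliary
terms** `G i j` (realizing `∂ⱼFᵢ`) and `H i j k` (realizing `∂ₖ∂ⱼFᵢ`): hypotheses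
`B · G(q̄) = 1`, `|Bᵢⱼ| ≤ β`, `|Fᵢ(q̄)| ≤ δ`, `|qᵢ| + 2nβδ ≤ ν`,
`4 · (Σ majFun ν (H i j k)) · (nβ) · (nβδ) ≤ 1`; conclusion: a non-singular zero of `F` within
`2nβδ` of `q̄`. [cite: JonesServi2011, Lemma 3.5 (proof)] -/
theorem exists_zero_of_newtonHyp_of_terms
    (G : Fin n → Fin n → Language.orderedExpRing.Term (Empty ⊕ Fin n))
    (H : Fin n → Fin n → Fin n → Language.orderedExpRing.Term (Empty ⊕ Fin n))
    (hG : ∀ (y : Fin n → ℝ) (i j : Fin n), jacFun F y i j = (G i j).realize (Sum.elim Empty.elim y))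
    (hH : ∀ (y : Fin n → ℝ) (i j k : Fin n),
      fderiv ℝ (fun y : Fin n → ℝ => (G i j).realize (Sum.elim Empty.elim y)) y (Pi.single k 1) =
        (H i j k).realize (Sum.elim Empty.elim y))
    {q : Fin n → ℝ} {B : Matrix (Fin n) (Fin n) ℝ} {β δ ν : ℝ}
    (hβ₀ : 0 ≤ β) (hδ₀ : 0 ≤ δ) (hν₀ : 0 ≤ ν)
    (hB : B * (Matrix.of fun i j => (G i j).realize (Sum.elim (Empty.elim : Empty → ℝ) q)) = 1)
    (hβ : ∀ i j, |B i j| ≤ β) (hδ : ∀ i, |sysFun F Empty.elim q i| ≤ δ)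
    (hν : ∀ i, |q i| + 2 * (n * β * δ) ≤ ν)
    (hsmall : 4 * (∑ i, ∑ j, ∑ k, majFun ν (H i j k)) * (n * β) * (n * β * δ) ≤ 1) :
    ∃ x : Fin n → ℝ, (∀ i, |x i - q i| ≤ 2 * (n * β * δ)) ∧ sysFun F Empty.elim x = 0 ∧
      ∃ B' : Matrix (Fin n) (Fin n) ℝ, B' * jacFun F x = 1 := by
  have hGq : (Matrix.of fun i j => (G i j).realize (Sum.elim (Empty.elim : Empty → ℝ) q)) =
      jacFun F q := by
    ext i j
    rw [Matrix.of_apply, ← hG q i j]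
  rw [hGq] at hB
  exact exists_zero_of_newtonHyp_of_lipschitz F hβ₀ hδ₀
    (Finset.sum_nonneg fun _ _ => Finset.sum_nonneg fun _ _ => Finset.sum_nonneg fun _ _ =>
      majFun_nonneg hν₀ _)
    (fun x a hx ha => norm_fderiv_sub_fderiv_le_of_terms F G H hG hH hx ha) hB hβ hδ hν hsmall

end System

end NewtonExp

end Literature.ModelTheory.ExponentialFields

end
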